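import Summits.QuantumFields.YangMills.Theorems.BalabanUVNodesN21ThresholdMixtureCommonBox
import Summits.QuantumFields.YangMills.Theorems.BalabanUVNodesClustersCore

/-!
# YM-DAG node N21 (= NE7c) — THE THRESHOLD MIXTURE, PART 6: the N20 FACE of the mixture carriers — King's relative bad-class bound
# `T4WeightBudget.RelWeightBound` (and the K5 stub `S_N20`) for threshold-AVERAGED carriers from print's SHARP bad-class bounds at every threshold
# assignment of the COMMON box

Track A of `YM-PLAN.md` (cell `pub-ymgap`, HUMAN RULING D-0062), node **N21** (its N20 in-edge on the mixture road); R141 (C) fan-out seat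
`pub-ymgap-dag-n21-e` (s3 = ALTERNATIVE CURRENCY), generation 3, file 12.  Companions: 5a `…N21ThresholdMixture` (p466893: `relBound_mixture_of_forall` —
ONE common space assumed), 10a `…N21ThresholdMixtureCommonBox` (p477986: `sum_average_le_sum_of_forall_proj`, `integrable_Xs_box`, `ae_mem_box_pi` — the
common space CONSTRUCTED as the product over occurrences), files 6 ∕ 8 ∕ 10b ∕ 11b (the N21 faces whose carriers `S.A`, `S.B` ARE threshold averages).
Kernel bookkeeping: 0 `def`, 0 `sorry`, standard axioms.  COUNT-NEUTRAL; `--supports` the K3′ item `SpineGivenEndpointR12` as a helper.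

THE POINT (joint sufficiency of the K5 bundle on ONE `SpineCarriers`).  The spine's K5 stubs `S_N19`, `S_N20`, `S_N21` are read on the SAME carriers `S`.
On the mixture road N21 is read for carriers `S.A`, `S.B` that are NORMALISED THRESHOLD AVERAGES of the runs' sharp weights (files 6 ∕ 8 ∕ 10b ∕ 11b); so
N20's statement `T4WeightBudget.RelWeightBound S.l₀ S.T S.A S.B S.Bad S.W` must be available for THOSE averages.  Print proves bad-class bounds for the
SHARP weights at any admissible thresholds ([Balaban1989LargeFieldII] (1.79)∕(1.84) pp. 383–385 — the species; `T4LipschitzCutoff` §5∕§7: the ladder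
slack is the worst case over independent multipliers).  A class-relative LINEAR inequality holding at every threshold assignment of the common box
passes to the averages (file 10a §3) — §1 `classBound_of_sharpCommonBox` says so in file 6's letters; §2 `relWeightBound_of_sharpCommonBox` assembles
N20's structure for the mixture carriers; §3 `s_N20_of_sharpCommonBoxReading` is the K5 stub `S_N20 SRec` for every carrier predicate handing that
package (a HELPER reading — N20's bound itself is DISPLAYED as `hbadA`∕`hbadB`, never discharged; N20's seats own the node).

HONEST FRAMING.  NE7b ∕ NE7c are NOT PRINTED as ratio statements and NOT PROVED; nothing of N20 is discharged here; (M1) untouched; N20 ∕ N21 NOT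
discharged; count-neutral; one finite four-torus programme at fixed `ε`; NOT continuum ∕ ℝ⁴ ∕ OS ∕ mass gap ∕ Clay.

CITATION HEADER (lean-in-tree rule 2026-08-18).  BY NAME: file 10a `sum_average_le_sum_of_forall_proj`, `integrable_Xs_box`, `ae_mem_box_pi`;
`T4WeightBudget.RelWeightBound` ([King1986] (3.10)–(3.11) p. 656 model; T4-DAG U5c); `T4LipschitzLedger.Pol`; `T4IndicatorShell.smallInd`; `…ClustersCore`
(`SpineCarriers`, `SpineRecordPred`, `S_N20`).  Context only (SHAPE): [Balaban1988Convergent] (2.17)∕(2.18) p. 257; [Balaban1989LargeFieldII] (1.79) p. 383.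

WHAT IS PROVED ([folklore]).  §1 **`classBound_of_sharpCommonBox`**, **`classSum_eq_of_sharpCommonBox`** (the E1∕E2 ∕ N27x face: a sharp decomposition of
unity at every threshold assignment ⇒ the averaged carriers sum to the same partition function) · §2 **`relWeightBound_of_sharpCommonBox`** · §3
`s_N20_of_sharpCommonBoxReading`.
-/

set_option autoImplicit false

noncomputable section

open MeasureTheory Set
open scoped BigOperators ENNReal

namespace Summit.QuantumFields.YangMills.Theorems.N21ThresholdMixtureCommonBoxRelWeight

open YMDAG.UVSplit (SpineCarriers SpineRecordPred S_N20)
open Literature.MathematicalPhysics.QuantumFieldTheory.Balaban1983to89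
open Literature.MathematicalPhysics.QuantumFieldTheory.Balaban1983to89.T4IndicatorShell
open Literature.MathematicalPhysics.QuantumFieldTheory.Balaban1983to89.T4LipschitzLedger
open Literature.MathematicalPhysics.QuantumFieldTheory.Balaban1983to89.T4WeightBudget (RelWeightBound)
open N21ThresholdMixtureCommonBox (sum_average_le_sum_of_forall_proj integrable_Xs_box ae_mem_box_pi average_comp_proj_pi
  integrable_comp_proj_pi)

/-! ## §1 A class-relative linear bound — and a decomposition of unity — on the common box pass to the threshold-averaged carriers -/

section ClassBound

variable {ι : Type*} {Ω : ℕ → ι → Type*} [∀ K τ, MeasurableSpace (Ω K τ)]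
  {l₀ : ℝ} {T : ℕ → Finset ι} {X : ℕ → ℝ → ι → ℝ} {κ : ℕ → ℝ}
  {μ : (K : ℕ) → (τ : ι) → Measure (Ω K τ)} [∀ K τ, SFinite (μ K τ)] {m : ℕ → ι → ℕ} {slot : ℕ → ι → ℕ → Σ _ : ℕ, ℕ}
  {pol : ℕ → ι → ℕ → Pol} {θ : ℕ → ι → ℕ → ℝ} {uX : (K : ℕ) → (τ : ι) → ℕ → Ω K τ → ℝ}
  {RX : (K : ℕ) → ℝ → (τ : ι) → Ω K τ → ℝ}
  {nC : ℕ → ℕ} {aC : ℕ → ℕ → ℕ} {θC : ℕ → ℕ → ℝ} {e : (K : ℕ) → (τ : ι) → Fin (m K τ) → Fin (nC K)}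

/-- **A CLASS-RELATIVE LINEAR BOUND ON THE COMMON BOX PASSES TO THE AVERAGED CARRIERS.**  ONE run with file 6's data (per-term s-finite spaces,
measurable tested variables, integrable threshold-free remainders, admissible widths `0 < κ_a`, the sharp weights `Xs` in the
threshold-free representation `hXs`, the carriers `X` PINNED as their normalised threshold averages `hX`) and the occurrence data of file 10a
(`nC`, `aC`, `θC > 0`, injective consistent coordinate maps `e`).  IF for the step `K`, the source `t` and a sub-class `Bad ⊆ T K` the SHARP weights
obey `Σ_{τ ∈ Bad} Xs K t τ (S ∘ e K τ) ≤ W · Σ_{τ ∈ T K} Xs K t τ (S ∘ e K τ)` for EVERY threshold assignment `S` of the closed common box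
`∏_c [(1 − κ_{aC K c})·θC K c, θC K c]`, THEN `Σ_{τ ∈ Bad} X K t τ ≤ W · Σ_{τ ∈ T K} X K t τ` — file 10a's `sum_average_le_sum_of_forall_proj` with the
box∕normaliser bookkeeping of its §4. [folklore] -/
theorem classBound_of_sharpCommonBox (Xs : (K : ℕ) → ℝ → (τ : ι) → (Fin (m K τ) → ℝ) → ℝ)
    (hκ : ∀ a, 0 < κ a) (meas : ∀ K, ∀ τ ∈ T K, ∀ i < m K τ, Measurable (uX K τ i))
    (rem_int : ∀ K t, |t| ≤ l₀ → ∀ τ ∈ T K, Integrable (RX K t τ) (μ K τ))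
    (hXs : ∀ K t, |t| ≤ l₀ → ∀ τ ∈ T K, ∀ s : Fin (m K τ) → ℝ,
      Xs K t τ s = ∫ v, (∏ i : Fin (m K τ), (pol K τ i).fac (smallInd (uX K τ i v) (s i))) * RX K t τ v ∂(μ K τ))
    (hX : ∀ K t, |t| ≤ l₀ → ∀ τ ∈ T K, X K t τ =
      (∏ i : Fin (m K τ), (κ (slot K τ i).1 * θ K τ i))⁻¹ *
        ∫ s, Xs K t τ s ∂(Measure.pi fun i : Fin (m K τ) =>
          volume.restrict (Icc ((1 - κ (slot K τ i).1) * θ K τ i) (θ K τ i))))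
    (hθC : ∀ K c, 0 < θC K c) (he : ∀ K, ∀ τ ∈ T K, Function.Injective (e K τ))
    (he_age : ∀ K, ∀ τ ∈ T K, ∀ j : Fin (m K τ), (slot K τ j).1 = aC K (e K τ j))
    (he_thr : ∀ K, ∀ τ ∈ T K, ∀ j : Fin (m K τ), θ K τ j = θC K (e K τ j))
    {K : ℕ} {t : ℝ} (ht : |t| ≤ l₀) {Bad : Finset ι} (hBad : Bad ⊆ T K) {W : ℝ}
    (hsharp : ∀ S : Fin (nC K) → ℝ, (∀ c : Fin (nC K), S c ∈ Icc ((1 - κ (aC K c)) * θC K c) (θC K c)) →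
      ∑ τ ∈ Bad, Xs K t τ (fun j => S (e K τ j)) ≤ W * ∑ τ ∈ T K, Xs K t τ (fun j => S (e K τ j))) :
    ∑ τ ∈ Bad, X K t τ ≤ W * ∑ τ ∈ T K, X K t τ := by
  set ν : Fin (nC K) → Measure ℝ := fun c => (volume : Measure ℝ).restrict (Icc ((1 - κ (aC K c)) * θC K c) (θC K c)) with hν
  have hmass : ∀ c, (ν c univ).toReal = κ (aC K c) * θC K c := by
    intro c
    have hle : 0 ≤ θC K c - (1 - κ (aC K c)) * θC K c := by nlinarith [hκ (aC K c), hθC K c]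
    simp only [hν, Measure.restrict_apply MeasurableSet.univ, Set.univ_inter, Real.volume_Icc]
    rw [ENNReal.toReal_ofReal hle]
    ring
  have hν0 : ∀ c, ν c univ ≠ 0 := by
    intro c h0
    have h := hmass c
    rw [h0, ENNReal.toReal_zero] at h
    exact (mul_pos (hκ (aC K c)) (hθC K c)).ne' h.symm
  have hbox : ∀ τ ∈ T K,
      (Measure.pi fun i : Fin (m K τ) => (volume : Measure ℝ).restrict (Icc ((1 - κ (slot K τ i).1) * θ K τ i) (θ K τ i))) =
        Measure.pi fun j => ν (e K τ j) := by
    intro τ hτ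
    congr 1
    funext j
    simp only [hν, he_age K τ hτ j, he_thr K τ hτ j]
  have hnorm : ∀ τ ∈ T K, (∏ i : Fin (m K τ), (κ (slot K τ i).1 * θ K τ i)) = ∏ j, (ν (e K τ j) univ).toReal := by
    intro τ hτ
    exact Finset.prod_congr rfl fun j _ => by rw [hmass, ← he_age K τ hτ j, ← he_thr K τ hτ j]
  have hR : ∀ τ ∈ T K, X K t τ = (∏ j, (ν (e K τ j) univ).toReal)⁻¹ * ∫ x, Xs K t τ x ∂(Measure.pi fun j => ν (e K τ j)) := by
    intro τ hτ
    rw [hX K t ht τ hτ, hnorm τ hτ, hbox τ hτ]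
  rw [Finset.sum_congr rfl fun τ hτ => hR τ (hBad hτ), Finset.sum_congr rfl hR]
  have hf : ∀ τ ∈ T K, Integrable (Xs K t τ) (Measure.pi fun j => ν (e K τ j)) := fun τ hτ =>
    integrable_Xs_box Xs (meas K τ hτ) (rem_int K t ht τ hτ) (hXs K t ht τ hτ) _ _
  have hae : ∀ᵐ S ∂(Measure.pi ν),
      ∑ τ ∈ Bad, Xs K t τ (fun j => S (e K τ j)) ≤ W * ∑ τ ∈ T K, Xs K t τ (fun j => S (e K τ j)) := by
    filter_upwards [ae_mem_box_pi (fun c : Fin (nC K) => (1 - κ (aC K c)) * θC K c) (fun c => θC K c)] with S hS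
    exact hsharp S hS
  exact sum_average_le_sum_of_forall_proj ν hν0 Bad (T K) (e K) (fun τ hτ => he K τ (hBad hτ)) (he K) (fun τ => Xs K t τ)
    (fun τ => Xs K t τ) W (fun τ hτ => hf τ (hBad hτ)) hf hae

/-- **THE E1∕E2 FACE: A DECOMPOSITION OF UNITY ON THE COMMON BOX PASSES TO THE AVERAGED CARRIERS.**  Same data.  IF the run's sharp weights
sum to the SAME number `Z` at EVERY threshold assignment `S` of the closed common box (print's expansion is a decomposition of the run's partition
function for ANY admissible thresholds — [Balaban1988Convergent] (2.17)∕(2.18) p. 257; `Z` = that partition function), THEN the averaged carriers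
sum to `Z` too: `Σ_{τ ∈ T K} X K t τ = Z` — node N27x's class-sum clause (`…ClustersCore.S_N27x`: `schemeZ … = Σ_τ S.A K t τ`) for mixture carriers.
Proof: each term's own-box average is its common-box average (file 10a `average_comp_proj_pi`), the sum of the common-box averages is the
average of the sum, which is the constant `Z` almost everywhere. [folklore] -/
theorem classSum_eq_of_sharpCommonBox (Xs : (K : ℕ) → ℝ → (τ : ι) → (Fin (m K τ) → ℝ) → ℝ)
    (hκ : ∀ a, 0 < κ a) (meas : ∀ K, ∀ τ ∈ T K, ∀ i < m K τ, Measurable (uX K τ i))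
    (rem_int : ∀ K t, |t| ≤ l₀ → ∀ τ ∈ T K, Integrable (RX K t τ) (μ K τ))
    (hXs : ∀ K t, |t| ≤ l₀ → ∀ τ ∈ T K, ∀ s : Fin (m K τ) → ℝ,
      Xs K t τ s = ∫ v, (∏ i : Fin (m K τ), (pol K τ i).fac (smallInd (uX K τ i v) (s i))) * RX K t τ v ∂(μ K τ))
    (hX : ∀ K t, |t| ≤ l₀ → ∀ τ ∈ T K, X K t τ =
      (∏ i : Fin (m K τ), (κ (slot K τ i).1 * θ K τ i))⁻¹ *
        ∫ s, Xs K t τ s ∂(Measure.pi fun i : Fin (m K τ) =>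
          volume.restrict (Icc ((1 - κ (slot K τ i).1) * θ K τ i) (θ K τ i))))
    (hθC : ∀ K c, 0 < θC K c) (he : ∀ K, ∀ τ ∈ T K, Function.Injective (e K τ))
    (he_age : ∀ K, ∀ τ ∈ T K, ∀ j : Fin (m K τ), (slot K τ j).1 = aC K (e K τ j))
    (he_thr : ∀ K, ∀ τ ∈ T K, ∀ j : Fin (m K τ), θ K τ j = θC K (e K τ j))
    {K : ℕ} {t : ℝ} (ht : |t| ≤ l₀) {Z : ℝ}
    (hunity : ∀ S : Fin (nC K) → ℝ, (∀ c : Fin (nC K), S c ∈ Icc ((1 - κ (aC K c)) * θC K c) (θC K c)) →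
      ∑ τ ∈ T K, Xs K t τ (fun j => S (e K τ j)) = Z) :
    ∑ τ ∈ T K, X K t τ = Z := by
  set ν : Fin (nC K) → Measure ℝ := fun c => (volume : Measure ℝ).restrict (Icc ((1 - κ (aC K c)) * θC K c) (θC K c)) with hν
  have hmass : ∀ c, (ν c univ).toReal = κ (aC K c) * θC K c := by
    intro c
    have hle : 0 ≤ θC K c - (1 - κ (aC K c)) * θC K c := by nlinarith [hκ (aC K c), hθC K c]
    simp only [hν, Measure.restrict_apply MeasurableSet.univ, Set.univ_inter, Real.volume_Icc]
    rw [ENNReal.toReal_ofReal hle]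
    ring
  have hν0 : ∀ c, ν c univ ≠ 0 := by
    intro c h0
    have h := hmass c
    rw [h0, ENNReal.toReal_zero] at h
    exact (mul_pos (hκ (aC K c)) (hθC K c)).ne' h.symm
  have hbox : ∀ τ ∈ T K,
      (Measure.pi fun i : Fin (m K τ) => (volume : Measure ℝ).restrict (Icc ((1 - κ (slot K τ i).1) * θ K τ i) (θ K τ i))) =
        Measure.pi fun j => ν (e K τ j) := by
    intro τ hτ
    congr 1
    funext j
    simp only [hν, he_age K τ hτ j, he_thr K τ hτ j]
  have hnorm : ∀ τ ∈ T K, (∏ i : Fin (m K τ), (κ (slot K τ i).1 * θ K τ i)) = ∏ j, (ν (e K τ j) univ).toReal := by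
    intro τ hτ
    exact Finset.prod_congr rfl fun j _ => by rw [hmass, ← he_age K τ hτ j, ← he_thr K τ hτ j]
  have hf : ∀ τ ∈ T K, Integrable (Xs K t τ) (Measure.pi fun j => ν (e K τ j)) := fun τ hτ =>
    integrable_Xs_box Xs (meas K τ hτ) (rem_int K t ht τ hτ) (hXs K t ht τ hτ) _ _
  -- every term's own-box average is its common-box average
  have hR : ∀ τ ∈ T K, X K t τ = (∏ c, (ν c univ).toReal)⁻¹ * ∫ S, Xs K t τ (fun j => S (e K τ j)) ∂(Measure.pi ν) := by
    intro τ hτ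
    rw [hX K t ht τ hτ, hnorm τ hτ, hbox τ hτ, average_comp_proj_pi ν hν0 (he K τ hτ) (hf τ hτ).aestronglyMeasurable]
  have hM : (∏ c, (ν c univ).toReal) ≠ 0 :=
    Finset.prod_ne_zero_iff.2 fun c _ => ENNReal.toReal_ne_zero.2 ⟨hν0 c, measure_ne_top _ _⟩
  rw [Finset.sum_congr rfl hR, ← Finset.mul_sum,
    ← integral_finsetSum _ fun τ hτ => integrable_comp_proj_pi ν (he K τ hτ) (hf τ hτ)]
  have hae : (fun S : Fin (nC K) → ℝ => ∑ τ ∈ T K, Xs K t τ (fun j => S (e K τ j))) =ᵐ[Measure.pi ν] fun _ => Z := by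
    filter_upwards [ae_mem_box_pi (fun c : Fin (nC K) => (1 - κ (aC K c)) * θC K c) (fun c => θC K c)] with S hS
    exact hunity S hS
  rw [integral_congr_ae hae, integral_const, smul_eq_mul, measureReal_def, Measure.pi_univ, ENNReal.toReal_prod, ← mul_assoc,
    inv_mul_cancel₀ hM, one_mul]

end ClassBound

/-! ## §2 N20's `RelWeightBound` for the mixture carriers from SHARP bad-class bounds on the common box -/

section RelWeight

variable {ι : Type*} {Ω : ℕ → ι → Type*} [∀ K τ, MeasurableSpace (Ω K τ)]
  {l₀ : ℝ} {T : ℕ → Finset ι} {A B : ℕ → ℝ → ι → ℝ} {Bad : ℕ → ℝ → Finset ι} {W : ℕ → ℝ} {κ : ℕ → ℝ}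
  {μ : (K : ℕ) → (τ : ι) → Measure (Ω K τ)} [∀ K τ, SFinite (μ K τ)] {m : ℕ → ι → ℕ} {slot : ℕ → ι → ℕ → Σ _ : ℕ, ℕ}
  {pol : ℕ → ι → ℕ → Pol} {θ : ℕ → ι → ℕ → ℝ} {uA uB : (K : ℕ) → (τ : ι) → ℕ → Ω K τ → ℝ}
  {RA RB : (K : ℕ) → ℝ → (τ : ι) → Ω K τ → ℝ}
  {nC : ℕ → ℕ} {aC : ℕ → ℕ → ℕ} {θC : ℕ → ℕ → ℝ} {e : (K : ℕ) → (τ : ι) → Fin (m K τ) → Fin (nC K)}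

/-- **N20's `RelWeightBound` FOR THE MIXTURE CARRIERS.**  Two runs on common per-term spaces with file 6's data (both runs' measurable tested
variables, integrable threshold-free remainders `R^A`, `R^B`, admissible widths, the sharp weights `Xs^A`, `Xs^B` in the
threshold-free representation and the carriers `A`, `B` PINNED as their normalised threshold averages), the occurrence data of file 10a, the
scalar fields of King's shape (`Bad K t ⊆ T K`, `0 ≤ W K < 1`, `Σ W < ∞`), and — DISPLAYED, N20's NE7b species in print's currency — the SHARP relative
bad-class bounds `hbadA`, `hbadB`: for every `K`, `|t| ≤ l₀` and EVERY threshold assignment `S` of the closed common box, `Σ_{τ ∈ Bad K t} Xs K t τ (S ∘ e)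
≤ W K · Σ_{τ ∈ T K} Xs K t τ (S ∘ e)` in each run.  THEN `T4WeightBudget.RelWeightBound l₀ T A B Bad W` holds for the AVERAGED carriers (§1 ×2).
CONDITIONAL on every displayed binder; nothing of N20 discharged. [folklore] -/
theorem relWeightBound_of_sharpCommonBox (XsA XsB : (K : ℕ) → ℝ → (τ : ι) → (Fin (m K τ) → ℝ) → ℝ)
    (hκ : ∀ a, 0 < κ a) (meas : ∀ K, ∀ τ ∈ T K, ∀ i < m K τ, Measurable (uA K τ i) ∧ Measurable (uB K τ i))
    (remA_int : ∀ K t, |t| ≤ l₀ → ∀ τ ∈ T K, Integrable (RA K t τ) (μ K τ))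
    (remB_int : ∀ K t, |t| ≤ l₀ → ∀ τ ∈ T K, Integrable (RB K t τ) (μ K τ))
    (hXsA : ∀ K t, |t| ≤ l₀ → ∀ τ ∈ T K, ∀ s : Fin (m K τ) → ℝ,
      XsA K t τ s = ∫ v, (∏ i : Fin (m K τ), (pol K τ i).fac (smallInd (uA K τ i v) (s i))) * RA K t τ v ∂(μ K τ))
    (hXsB : ∀ K t, |t| ≤ l₀ → ∀ τ ∈ T K, ∀ s : Fin (m K τ) → ℝ,
      XsB K t τ s = ∫ v, (∏ i : Fin (m K τ), (pol K τ i).fac (smallInd (uB K τ i v) (s i))) * RB K t τ v ∂(μ K τ))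
    (hA : ∀ K t, |t| ≤ l₀ → ∀ τ ∈ T K, A K t τ =
      (∏ i : Fin (m K τ), (κ (slot K τ i).1 * θ K τ i))⁻¹ *
        ∫ s, XsA K t τ s ∂(Measure.pi fun i : Fin (m K τ) =>
          volume.restrict (Icc ((1 - κ (slot K τ i).1) * θ K τ i) (θ K τ i))))
    (hB : ∀ K t, |t| ≤ l₀ → ∀ τ ∈ T K, B K t τ =
      (∏ i : Fin (m K τ), (κ (slot K τ i).1 * θ K τ i))⁻¹ *
        ∫ s, XsB K t τ s ∂(Measure.pi fun i : Fin (m K τ) =>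
          volume.restrict (Icc ((1 - κ (slot K τ i).1) * θ K τ i) (θ K τ i))))
    (hθC : ∀ K c, 0 < θC K c) (he : ∀ K, ∀ τ ∈ T K, Function.Injective (e K τ))
    (he_age : ∀ K, ∀ τ ∈ T K, ∀ j : Fin (m K τ), (slot K τ j).1 = aC K (e K τ j))
    (he_thr : ∀ K, ∀ τ ∈ T K, ∀ j : Fin (m K τ), θ K τ j = θC K (e K τ j))
    (bad_subset : ∀ K t, |t| ≤ l₀ → Bad K t ⊆ T K) (nonneg : ∀ K, 0 ≤ W K) (lt_one : ∀ K, W K < 1) (summable : Summable W)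
    (hbadA : ∀ K t, |t| ≤ l₀ → ∀ S : Fin (nC K) → ℝ, (∀ c : Fin (nC K), S c ∈ Icc ((1 - κ (aC K c)) * θC K c) (θC K c)) →
      ∑ τ ∈ Bad K t, XsA K t τ (fun j => S (e K τ j)) ≤ W K * ∑ τ ∈ T K, XsA K t τ (fun j => S (e K τ j)))
    (hbadB : ∀ K t, |t| ≤ l₀ → ∀ S : Fin (nC K) → ℝ, (∀ c : Fin (nC K), S c ∈ Icc ((1 - κ (aC K c)) * θC K c) (θC K c)) →
      ∑ τ ∈ Bad K t, XsB K t τ (fun j => S (e K τ j)) ≤ W K * ∑ τ ∈ T K, XsB K t τ (fun j => S (e K τ j))) :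
    RelWeightBound l₀ T A B Bad W where
  bad_subset := bad_subset
  nonneg := nonneg
  lt_one := lt_one
  summable := summable
  bad_left K t ht :=
    classBound_of_sharpCommonBox XsA hκ (fun K τ hτ i hi => (meas K τ hτ i hi).1) remA_int hXsA hA hθC he he_age he_thr ht
      (bad_subset K t ht) (hbadA K t ht)
  bad_right K t ht :=
    classBound_of_sharpCommonBox XsB hκ (fun K τ hτ i hi => (meas K τ hτ i hi).2) remB_int hXsB hB hθC he he_age he_thr ht
      (bad_subset K t ht) (hbadB K t ht)

end RelWeight

/-! ## §3 At the spine carriers: the K5 stub `S_N20` for every common-box sharp-mixture reading of the bad-class bounds -/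

section AtCarriers

variable {N : ℕ} [NeZero N]

/-- **`S_N20` FOR EVERY COMMON-BOX SHARP-MIXTURE READING OF THE BAD-CLASS BOUNDS** (a helper reading; N20's bound itself stays displayed).  If
the carrier predicate `SRec` hands, with every bundle `S` it pins, the data of §2 for the carriers `S.A`, `S.B`, the bad classes `S.Bad` and the
weights `S.W` — per-term measurable spaces with s-finite measures, admissible widths, factor data, measurable tested variables, integrable
threshold-free remainders, the sharp weights with `S.A`, `S.B` PINNED as their normalised threshold averages, the occurrence structure, the scalar
fields, and the SHARP relative bad-class bounds at every threshold assignment of the common box in both runs — then `S_N20 SRec`. [folklore] -/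
theorem s_N20_of_sharpCommonBoxReading (SRec : SpineRecordPred N)
    (hread : ∀ (F : T4Continuum.T4Family) (D : YMDAG.UVSplit.Datum F N) (g₀ : ℕ → ℝ)
      (os : List (T4Continuum.ULoop F)) (S : SpineCarriers), SRec F D g₀ os S →
      ∃ (Ω : ℕ → S.ι → Type) (_mΩ : ∀ K τ, MeasurableSpace (Ω K τ)) (μ : (K : ℕ) → (τ : S.ι) → Measure (Ω K τ))
        (_sf : ∀ K τ, SFinite (μ K τ)) (κ : ℕ → ℝ) (m : ℕ → S.ι → ℕ) (slot : ℕ → S.ι → ℕ → Σ _ : ℕ, ℕ)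
        (pol : ℕ → S.ι → ℕ → Pol) (θ : ℕ → S.ι → ℕ → ℝ) (uA uB : (K : ℕ) → (τ : S.ι) → ℕ → Ω K τ → ℝ)
        (RA RB : (K : ℕ) → ℝ → (τ : S.ι) → Ω K τ → ℝ) (XsA XsB : (K : ℕ) → ℝ → (τ : S.ι) → (Fin (m K τ) → ℝ) → ℝ)
        (nC : ℕ → ℕ) (aC : ℕ → ℕ → ℕ) (θC : ℕ → ℕ → ℝ) (e : (K : ℕ) → (τ : S.ι) → Fin (m K τ) → Fin (nC K)),
        (∀ a, 0 < κ a) ∧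
        (∀ K, ∀ τ ∈ S.T K, ∀ i < m K τ, Measurable (uA K τ i) ∧ Measurable (uB K τ i)) ∧
        (∀ K t, |t| ≤ S.l₀ → ∀ τ ∈ S.T K, Integrable (RA K t τ) (μ K τ)) ∧
        (∀ K t, |t| ≤ S.l₀ → ∀ τ ∈ S.T K, Integrable (RB K t τ) (μ K τ)) ∧
        (∀ K t, |t| ≤ S.l₀ → ∀ τ ∈ S.T K, ∀ s : Fin (m K τ) → ℝ,
          XsA K t τ s = ∫ v, (∏ i : Fin (m K τ), (pol K τ i).fac (smallInd (uA K τ i v) (s i))) * RA K t τ v ∂(μ K τ)) ∧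
        (∀ K t, |t| ≤ S.l₀ → ∀ τ ∈ S.T K, ∀ s : Fin (m K τ) → ℝ,
          XsB K t τ s = ∫ v, (∏ i : Fin (m K τ), (pol K τ i).fac (smallInd (uB K τ i v) (s i))) * RB K t τ v ∂(μ K τ)) ∧
        (∀ K t, |t| ≤ S.l₀ → ∀ τ ∈ S.T K, S.A K t τ =
          (∏ i : Fin (m K τ), (κ (slot K τ i).1 * θ K τ i))⁻¹ *
            ∫ s, XsA K t τ s ∂(Measure.pi fun i : Fin (m K τ) =>
              volume.restrict (Icc ((1 - κ (slot K τ i).1) * θ K τ i) (θ K τ i)))) ∧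
        (∀ K t, |t| ≤ S.l₀ → ∀ τ ∈ S.T K, S.B K t τ =
          (∏ i : Fin (m K τ), (κ (slot K τ i).1 * θ K τ i))⁻¹ *
            ∫ s, XsB K t τ s ∂(Measure.pi fun i : Fin (m K τ) =>
              volume.restrict (Icc ((1 - κ (slot K τ i).1) * θ K τ i) (θ K τ i)))) ∧
        (∀ K c, 0 < θC K c) ∧ (∀ K, ∀ τ ∈ S.T K, Function.Injective (e K τ)) ∧
        (∀ K, ∀ τ ∈ S.T K, ∀ j : Fin (m K τ), (slot K τ j).1 = aC K (e K τ j)) ∧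
        (∀ K, ∀ τ ∈ S.T K, ∀ j : Fin (m K τ), θ K τ j = θC K (e K τ j)) ∧
        (∀ K t, |t| ≤ S.l₀ → S.Bad K t ⊆ S.T K) ∧ (∀ K, 0 ≤ S.W K) ∧ (∀ K, S.W K < 1) ∧ Summable S.W ∧
        (∀ K t, |t| ≤ S.l₀ → ∀ Sv : Fin (nC K) → ℝ, (∀ c : Fin (nC K), Sv c ∈ Icc ((1 - κ (aC K c)) * θC K c) (θC K c)) →
          ∑ τ ∈ S.Bad K t, XsA K t τ (fun j => Sv (e K τ j)) ≤ S.W K * ∑ τ ∈ S.T K, XsA K t τ (fun j => Sv (e K τ j))) ∧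
        (∀ K t, |t| ≤ S.l₀ → ∀ Sv : Fin (nC K) → ℝ, (∀ c : Fin (nC K), Sv c ∈ Icc ((1 - κ (aC K c)) * θC K c) (θC K c)) →
          ∑ τ ∈ S.Bad K t, XsB K t τ (fun j => Sv (e K τ j)) ≤ S.W K * ∑ τ ∈ S.T K, XsB K t τ (fun j => Sv (e K τ j)))) :
    S_N20 SRec := by
  intro F D g₀ os S hS
  obtain ⟨Ω, mΩ, μ, sf, κ, m, slot, pol, θ, uA, uB, RA, RB, XsA, XsB, nC, aC, θC, e, hκ, meas, remA_int, remB_int, hXsA, hXsB, hA, hB,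
    hθC, he, he_age, he_thr, bad_subset, nonneg, lt_one, summable, hbadA, hbadB⟩ := hread F D g₀ os S hS
  exact relWeightBound_of_sharpCommonBox XsA XsB hκ meas remA_int remB_int hXsA hXsB hA hB hθC he he_age he_thr bad_subset nonneg lt_one
    summable hbadA hbadB

end AtCarriers

end Summit.QuantumFields.YangMills.Theorems.N21ThresholdMixtureCommonBoxRelWeight

end
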